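import Literature.MathematicalPhysics.QuantumFieldTheory.Balaban1983to89.B13OpsYPencilXQuad

/-!
# `Balaban1983to89.B13OpsYPencilRProj` — T. Bałaban, *Propagators for lattice gauge theories in a background field*, Commun. Math. Phys. **99** (1985)
389–434 [Balaban1985BackgroundPropagators], (3.19)–(3.21) pp. 393–394 (`Q′(U)`), (3.24)–(3.25) pp. 394–395 (`Q′*`, «R(U) = I − G′(U)Q′*(U)(Q′(U)G′(U)²Q′*(U))⁻¹
Q′(U)G′(U)»), Thm 3.4 p. 400, Sect. B (3.66)–(3.68) p. 403, (3.69)–(3.70) p. 404, (3.71)–(3.72) p. 405 («R(U′U) … analytic functions of A′»), Thm 3.10 (3.107)–(3.108) p. 416; *Renormalization group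
approach to lattice gauge field theories. II*, Commun. Math. Phys. **116** (1988) 1–22 [Balaban1988RG2Cluster] (2.5)–(2.7) pp. 12–13, p. 15: THE R-STATION —
NODE 00's PROJECTION `R(U)` (`Node00.RY i parS Gp`) IN THE N10 ENTRY-LETTER CURRENCY ALONG pv27's PENCIL, TRANSPORTER-GENERIC: for ANY site transporter
letter `parS` (def-Y's v2 `parSY` or v4 `parSymY` — which one is «of record» is NODE 00's ∕ def-T's word, located by dag-n10-c g15) and ANY `G′`-letter `Gp`.

`R = 1 − G′·(Q′*·X⁻¹·Q′)·G′`: the middle factor is a u-dependent LOCAL RECTANGULAR sandwich of the block-sector square family `X⁻¹` located on SITES ((D′)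
`rawEntryLetters_sandwich_family`), then two square products with `G′` (34 `rawEntryLetters_mul_torus`, one rate loss each), then `1 − ·` (34).  The only
analytic facts about `parS` needed — holomorphy of `A′ ↦ qpT i parS (e^{iηA′}U₀) s z` and of its inverse on the chart ball, and ONE bound numeral `KQ` on the
supports of `qpK ∕ qpsK` — are DISPLAYED (§1), discharged at `parSY` by 73 (§4) and at `parSymY` by the lane's module 78.
* §1 TRANSPORTER-GENERIC `Q′ ∕ Q′*` RECTANGULAR FAMILIES (over `B13OpsYPencilXQuad.toMatrix_QpY_eq ∕ _QpsY_eq`, 68 `differentiableOn_coord_trLift`, 73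
  `norm_coord_trLift_le_of_support`): `differentiableOn_toMatrix_QpY_prodCfg_of ∕ …QpsY…`, `norm_toMatrix_QpY_prodCfg_le_of ∕ …QpsY…` (`≤ |qpK|·cb·(KQ·cl·KQ)`),
  `rowSum_blk_toMatrix_QpsY_le_of` (rows of `toMatrix(Q′*)` over the block index, numeral `CQsr ≥ Σ_s|qpsK(z,s)|`), `colSum_blk_toMatrix_QpY_le_of` (columns of
  `toMatrix(Q′)` over the block index, numeral `CQc ≥ Σ_s|qpK(s,z)|`).
* §2 `toMatrix_RY_eq` (`toMatrix(R(U)) = 1 − toMatrix(G′)·((toMatrix(Q′*)·toMatrix(X⁻¹)·toMatrix(Q′))·toMatrix(G′))`, any `parS`, `Gp`, `U`).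
* §3 ★★★ `rawEntryLetters_toMatrix_RY_prodCfg` — for ANY `parS`, `Gp`: from `G′`'s pencil letters `(R, ρ, B_G′)` on sites (`A′ ↦ toMatrix (Gp (e^{iηA′}U₀))`) and
  X⁻¹'s pencil letters `(R, ρ, B_X)` on blocks (`A′ ↦ toMatrix (XinvY i parS Gp (e^{iηA′}U₀))`) — the G′- and X⁻¹-junctions' OUTPUTS, displayed so the stations
  compose BY NAME —, §1's four transporter facts, a fibre bound `m_S`, `0 < μ`, `2μ ≤ ρ`, the kernel numerals: `RawEntryLetters (A′ ↦ toMatrix (R(e^{iηA′}U₀)))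
  (ℓS ∘ fst) R (ρ − 2μ) (1 + B_G′·(B_N·B_G′·M)·M)`, `M = m_S·c₀(1,μ)^ν`, `B_N = a·b·B_X·e^{2ρr}` — print's «R(U′U) … analytic in A′».
* §4 `rawEntryLetters_toMatrix_RY_parSY_prodCfg` — the v2 INSTANCE: §1's transporter facts at `parS := parSY i` discharged by 73 (`differentiableOn_qpT(_inv)_prodCfg`,
  `norm_qpT(_inv)_prodCfg_le` with the support numeral `D`: `KQ = Kη^D`).
HONEST FRAMING: readers + located numerals over (D′) ∕ 34 ∕ 68 ∕ 73 ∕ p599011–p605318; NODE 00's `RY ∕ QpY ∕ QpsY ∕ qpT ∕ XinvY ∕ GpY ∕ parSY`, pv27's `prodCfg`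
CONSUMED BY NAME, nothing of `Node00/OpsY*` modified; the two junction outputs stay displayed hypotheses (they carry N06's Thm 3.1 ∕ 3.2 ∕ 3.10 at `U₀`); nothing
of Bałaban's asserted; N06 ∕ N10 NOT discharged; K1⁷ NOT closed; counts unmoved (typed 28∕28 · discharged 5∕27); THEOREMS ONLY, 0 `sorry`, standard axioms; one
finite 𝕋⁴ programme at fixed ε — R4 closes the conditional finite-𝕋⁴ rung `BalabanLadder.UV` only; the YM mass gap (Clay) is NOT proved by any of this;
nothing continuum ∕ ℝ⁴ ∕ OS.

References: T. Bałaban, CMP 99 (1985) 389–434 [Balaban1985BackgroundPropagators] (3.19)–(3.21) pp.393–394, (3.24)–(3.27) pp.394–395, Thm 3.4 p.400, (3.66)–(3.68) p.403,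
(3.69)–(3.70) p.404, (3.71)–(3.72) p.405, Thm 3.10 (3.107)–(3.108) pp.415–416; CMP 116 (1988) 1–22 [Balaban1988RG2Cluster] (2.5)–(2.7) pp.12–13, p.15; CMP 96 (1984) 223–250
[Balaban1984PropagatorsII] (2.54) p.232, Lemma 2.1 (2.61) p.234.
DOC-ONLY EDITION (dag-n10-w2 g4, 2026-08-28): [B9] page locators corrected per the page owner lit-balaban-r06 — (3.25) p.394; (3.48) p.398; (3.60)–(3.65) p.402,
(3.66)–(3.68) p.403, (3.69)–(3.70) p.404, (3.71)–(3.72) p.405; (3.84)–(3.86) p.407 only; every declaration byte-identical to the previous edition.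
-/

noncomputable section

namespace Literature.MathematicalPhysics.QuantumFieldTheory.Balaban1983to89.B13OpsYPencilRProj

open Metric Set Finset Module
open scoped Matrix
open Literature.MathematicalPhysics.QuantumFieldTheory.Balaban1983to89
open Literature.MathematicalPhysics.QuantumFieldTheory.Balaban1983to89.B9Thm37GlueTorus (tdist1)
open Literature.MathematicalPhysics.QuantumFieldTheory.Balaban1983to89.B5TorusCover (UT)
open Literature.MathematicalPhysics.QuantumFieldTheory.Balaban1983to89.B13EntrywiseWalks (RawEntryLetters)
open Literature.MathematicalPhysics.QuantumFieldTheory.Balaban1983to89.B13EntryLetterAlgebra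
  (rawEntryLetters_mono rawEntryLetters_congr rawEntryLetters_mul_torus rawEntryLetters_one rawEntryLetters_sub)
open Literature.MathematicalPhysics.QuantumFieldTheory.Balaban1983to89.B13EntryLetterAlgebraFamily (rawEntryLetters_sandwich_family)
open Literature.MathematicalPhysics.QuantumFieldTheory.Balaban1983to89.B13OpsYPencilXQuad
  (toMatrix_piProd_rect_apply toMatrix_QpY_eq toMatrix_QpsY_eq tdist_le_of_toMatrix_QpY_ne_zero tdist_le_of_toMatrix_QpsY_ne_zero)
open Literature.MathematicalPhysics.QuantumFieldTheory.Balaban1983to89.B13TransportedLiftLetters (differentiableOn_coord_trLift)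
open Literature.MathematicalPhysics.QuantumFieldTheory.Balaban1983to89.B13OpsYPencilAveraging
  (norm_coord_trLift_le_of_support differentiableOn_qpT_prodCfg differentiableOn_qpT_inv_prodCfg norm_qpT_prodCfg_le norm_qpT_inv_prodCfg_le)
open Literature.MathematicalPhysics.QuantumFieldTheory.Balaban1983to89.B9Eq39Adjoint (R R_def prodCfg)
open Literature.MathematicalPhysics.QuantumFieldTheory.Balaban1983to89.B6GlobalChartV1 (PV boxEquiv)
open Literature.MathematicalPhysics.QuantumFieldTheory.Balaban1983to89.B6KLevelCensusIndexV1 (KIdx)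
open Literature.MathematicalPhysics.QuantumFieldTheory.Balaban1983to89.Node00

variable {𝔸 : Type} [NormedRing 𝔸] [NormedAlgebra ℂ 𝔸] [CompleteSpace 𝔸]
variable {d ℓ : ℕ} {hd : 1 ≤ d + 1} {hL : Odd (ℓ + 1) ∧ 1 < ℓ + 1} {b₀ b₁ : ℝ}
variable (i : KIdx d ℓ hd hL b₀ b₁)
variable {κ : Type} [Fintype κ] [DecidableEq κ] (b : Basis κ ℂ 𝔸)
variable (parS : SiteParY 𝔸 i) (U₀ : CfgY 𝔸 i) (η : ℝ) {Rc KQ : ℝ}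
variable [DecidableEq (SiteY i)] [DecidableEq (BlkY i)]

/-! ## §1. Transporter-generic `Q′ ∕ Q′*` rectangular families along the pencil -/

section Generic

omit [DecidableEq (BlkY i)] in
/-- `Q′` along the pencil, ANY `parS`: every rectangular matrix entry is HOLOMORPHIC once `A′ ↦ qpT i parS (e^{iηA′}U₀) s z` and its inverse are (68
`differentiableOn_coord_trLift` at `φ_k := (b.coord k).mkContinuous cb`). [cite: Balaban1985BackgroundPropagators, (3.19), (3.21) pp.393–394, Thm 3.4 p.400] -/
theorem differentiableOn_toMatrix_QpY_prodCfg_of {cb : ℝ} (hcb : ∀ (x : 𝔸) (k : κ), ‖b.repr x k‖ ≤ cb * ‖x‖)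
    (hQh : ∀ s z, DifferentiableOn ℂ (fun a : Fin (d + 1) → Site (PV d ℓ i.m i.K hd hL) 0 → 𝔸 => (qpT i parS (prodCfg U₀ η a) s z : 𝔸)) (ball 0 Rc))
    (hQhi : ∀ s z, DifferentiableOn ℂ (fun a : Fin (d + 1) → Site (PV d ℓ i.m i.K hd hL) 0 → 𝔸 =>
      (((qpT i parS (prodCfg U₀ η a) s z)⁻¹ : 𝔸ˣ) : 𝔸)) (ball 0 Rc))
    (p : BlkY i × κ) (q : SiteY i × κ) :
    DifferentiableOn ℂ (fun a : Fin (d + 1) → Site (PV d ℓ i.m i.K hd hL) 0 → 𝔸 =>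
      LinearMap.toMatrix ((Pi.basis fun _ : SiteY i => b).reindex (Equiv.sigmaEquivProd (SiteY i) κ))
        ((Pi.basis fun _ : BlkY i => b).reindex (Equiv.sigmaEquivProd (BlkY i) κ)) (QpY i parS (prodCfg U₀ η a)) p q) (ball 0 Rc) := by
  obtain ⟨s, k⟩ := p
  obtain ⟨z, l⟩ := q
  have h := differentiableOn_coord_trLift (qpK i) (fun a => qpT i parS (prodCfg U₀ η a))
    (fun k => (b.coord k).mkContinuous cb (fun x => by rw [Basis.coord_apply]; exact hcb x k)) b hQh hQhi s z k l
  refine h.congr fun a _ => ?_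
  rw [toMatrix_QpY_eq, LinearMap.mkContinuous_apply, Basis.coord_apply]

omit [DecidableEq (SiteY i)] in
/-- `Q′*` along the pencil, ANY `parS`: every rectangular matrix entry is HOLOMORPHIC (the inverted transporters).
[cite: Balaban1985BackgroundPropagators, (3.24) p.394, Thm 3.4 p.400] -/
theorem differentiableOn_toMatrix_QpsY_prodCfg_of {cb : ℝ} (hcb : ∀ (x : 𝔸) (k : κ), ‖b.repr x k‖ ≤ cb * ‖x‖)
    (hQh : ∀ s z, DifferentiableOn ℂ (fun a : Fin (d + 1) → Site (PV d ℓ i.m i.K hd hL) 0 → 𝔸 => (qpT i parS (prodCfg U₀ η a) s z : 𝔸)) (ball 0 Rc))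
    (hQhi : ∀ s z, DifferentiableOn ℂ (fun a : Fin (d + 1) → Site (PV d ℓ i.m i.K hd hL) 0 → 𝔸 =>
      (((qpT i parS (prodCfg U₀ η a) s z)⁻¹ : 𝔸ˣ) : 𝔸)) (ball 0 Rc))
    (q : SiteY i × κ) (p : BlkY i × κ) :
    DifferentiableOn ℂ (fun a : Fin (d + 1) → Site (PV d ℓ i.m i.K hd hL) 0 → 𝔸 =>
      LinearMap.toMatrix ((Pi.basis fun _ : BlkY i => b).reindex (Equiv.sigmaEquivProd (BlkY i) κ))
        ((Pi.basis fun _ : SiteY i => b).reindex (Equiv.sigmaEquivProd (SiteY i) κ)) (QpsY i parS (prodCfg U₀ η a)) q p) (ball 0 Rc) := by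
  obtain ⟨z, k⟩ := q
  obtain ⟨s, l⟩ := p
  have h := differentiableOn_coord_trLift (qpsK i) (fun a z s => (qpT i parS (prodCfg U₀ η a) s z)⁻¹)
    (fun k => (b.coord k).mkContinuous cb (fun x => by rw [Basis.coord_apply]; exact hcb x k)) b
    (fun z s => hQhi s z) (fun z s => by simpa only [inv_inv] using hQh s z) z s k l
  refine h.congr fun a _ => ?_
  rw [toMatrix_QpsY_eq, LinearMap.mkContinuous_apply, Basis.coord_apply]

variable {ν : ℕ} {Nf : Fin ν → ℕ} [∀ j, NeZero (Nf j)]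

omit [DecidableEq (BlkY i)] in
/-- `Q′`, ANY `parS`: ENTRY BOUND `≤ |qpK(s,z)|·(cb·(KQ·cl·KQ))` from ONE transporter numeral `KQ ≥ 0` on `qpK`'s support (73 `norm_coord_trLift_le_of_support`).
[cite: Balaban1985BackgroundPropagators, (3.19) p.393, (3.40) p.397, (3.108) p.416] -/
theorem norm_toMatrix_QpY_prodCfg_le_of {cb cl : ℝ} (hcb : ∀ (x : 𝔸) (k : κ), ‖b.repr x k‖ ≤ cb * ‖x‖) (hcb0 : 0 ≤ cb) (hcl : ∀ l, ‖b l‖ ≤ cl)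
    (hKQ : 0 ≤ KQ)
    (hQf : ∀ a ∈ ball (0 : Fin (d + 1) → Site (PV d ℓ i.m i.K hd hL) 0 → 𝔸) Rc, ∀ s z, qpK i s z ≠ 0 → ‖(qpT i parS (prodCfg U₀ η a) s z : 𝔸)‖ ≤ KQ)
    (hQb : ∀ a ∈ ball (0 : Fin (d + 1) → Site (PV d ℓ i.m i.K hd hL) 0 → 𝔸) Rc, ∀ s z, qpK i s z ≠ 0 →
      ‖(((qpT i parS (prodCfg U₀ η a) s z)⁻¹ : 𝔸ˣ) : 𝔸)‖ ≤ KQ)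
    {a : Fin (d + 1) → Site (PV d ℓ i.m i.K hd hL) 0 → 𝔸} (ha : a ∈ ball 0 Rc) (p : BlkY i × κ) (q : SiteY i × κ) :
    ‖LinearMap.toMatrix ((Pi.basis fun _ : SiteY i => b).reindex (Equiv.sigmaEquivProd (SiteY i) κ))
      ((Pi.basis fun _ : BlkY i => b).reindex (Equiv.sigmaEquivProd (BlkY i) κ)) (QpY i parS (prodCfg U₀ η a)) p q‖ ≤
      |qpK i p.1 q.1| * (cb * (KQ * cl * KQ)) := by
  obtain ⟨s, k⟩ := p
  obtain ⟨z, l⟩ := q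
  set φ : κ → 𝔸 →L[ℂ] ℂ := fun k => (b.coord k).mkContinuous cb (fun x => by rw [Basis.coord_apply]; exact hcb x k) with hφ
  have e1 : LinearMap.toMatrix ((Pi.basis fun _ : SiteY i => b).reindex (Equiv.sigmaEquivProd (SiteY i) κ))
      ((Pi.basis fun _ : BlkY i => b).reindex (Equiv.sigmaEquivProd (BlkY i) κ)) (QpY i parS (prodCfg U₀ η a)) (s, k) (z, l) =
      ((qpK i s z : ℝ) : ℂ) * φ k (R (qpT i parS (prodCfg U₀ η a) s z) (b l)) := by
    rw [toMatrix_QpY_eq, hφ, LinearMap.mkContinuous_apply, Basis.coord_apply]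
  rw [e1]
  refine (norm_coord_trLift_le_of_support (qpK i) (fun a => qpT i parS (prodCfg U₀ η a)) φ b hKQ hQf hQb ha s z k l).trans ?_
  refine mul_le_mul_of_nonneg_left ?_ (abs_nonneg _)
  refine mul_le_mul (LinearMap.mkContinuous_norm_le _ hcb0 _) ?_ (by positivity) hcb0
  exact mul_le_mul_of_nonneg_right (mul_le_mul_of_nonneg_left (hcl l) hKQ) hKQ

omit [DecidableEq (SiteY i)] in
/-- `Q′*`, ANY `parS`: ENTRY BOUND `≤ |qpsK(z,s)|·(cb·(KQ·cl·KQ))` from the transporter numeral `KQ` on `qpsK`'s support.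
[cite: Balaban1985BackgroundPropagators, (3.24) p.394, (3.40) p.397, (3.108) p.416] -/
theorem norm_toMatrix_QpsY_prodCfg_le_of {cb cl : ℝ} (hcb : ∀ (x : 𝔸) (k : κ), ‖b.repr x k‖ ≤ cb * ‖x‖) (hcb0 : 0 ≤ cb) (hcl : ∀ l, ‖b l‖ ≤ cl)
    (hKQ : 0 ≤ KQ)
    (hQsf : ∀ a ∈ ball (0 : Fin (d + 1) → Site (PV d ℓ i.m i.K hd hL) 0 → 𝔸) Rc, ∀ z s, qpsK i z s ≠ 0 →
      ‖(((qpT i parS (prodCfg U₀ η a) s z)⁻¹ : 𝔸ˣ) : 𝔸)‖ ≤ KQ)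
    (hQsb : ∀ a ∈ ball (0 : Fin (d + 1) → Site (PV d ℓ i.m i.K hd hL) 0 → 𝔸) Rc, ∀ z s, qpsK i z s ≠ 0 → ‖(qpT i parS (prodCfg U₀ η a) s z : 𝔸)‖ ≤ KQ)
    {a : Fin (d + 1) → Site (PV d ℓ i.m i.K hd hL) 0 → 𝔸} (ha : a ∈ ball 0 Rc) (q : SiteY i × κ) (p : BlkY i × κ) :
    ‖LinearMap.toMatrix ((Pi.basis fun _ : BlkY i => b).reindex (Equiv.sigmaEquivProd (BlkY i) κ))
      ((Pi.basis fun _ : SiteY i => b).reindex (Equiv.sigmaEquivProd (SiteY i) κ)) (QpsY i parS (prodCfg U₀ η a)) q p‖ ≤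
      |qpsK i q.1 p.1| * (cb * (KQ * cl * KQ)) := by
  obtain ⟨z, k⟩ := q
  obtain ⟨s, l⟩ := p
  set φ : κ → 𝔸 →L[ℂ] ℂ := fun k => (b.coord k).mkContinuous cb (fun x => by rw [Basis.coord_apply]; exact hcb x k) with hφ
  have e1 : LinearMap.toMatrix ((Pi.basis fun _ : BlkY i => b).reindex (Equiv.sigmaEquivProd (BlkY i) κ))
      ((Pi.basis fun _ : SiteY i => b).reindex (Equiv.sigmaEquivProd (SiteY i) κ)) (QpsY i parS (prodCfg U₀ η a)) (z, k) (s, l) =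
      ((qpsK i z s : ℝ) : ℂ) * φ k (R (qpT i parS (prodCfg U₀ η a) s z)⁻¹ (b l)) := by
    rw [toMatrix_QpsY_eq, hφ, LinearMap.mkContinuous_apply, Basis.coord_apply]
  rw [e1]
  have h := norm_coord_trLift_le_of_support (qpsK i) (fun a z s => (qpT i parS (prodCfg U₀ η a) s z)⁻¹) φ b hKQ hQsf
    (fun a ha z s hM => by simpa only [inv_inv] using hQsb a ha z s hM) ha z s k l
  refine h.trans ?_
  refine mul_le_mul_of_nonneg_left ?_ (abs_nonneg _)
  refine mul_le_mul (LinearMap.mkContinuous_norm_le _ hcb0 _) ?_ (by positivity) hcb0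
  exact mul_le_mul_of_nonneg_right (mul_le_mul_of_nonneg_left (hcl l) hKQ) hKQ

omit [DecidableEq (SiteY i)] in
/-- `Q′*`, ANY `parS`: ROW SUMS over the block index `Σ_{(s,l)} ‖toMatrix(Q′*)(z,k)(s,l)‖ ≤ CQsr·|κ|·(cb·(KQ·cl·KQ))`, numeral `CQsr ≥ Σ_s |qpsK(z,s)|`.
[cite: Balaban1985BackgroundPropagators, (3.24) p.394; Balaban1984PropagatorsII, (2.54) p.232] -/
theorem rowSum_blk_toMatrix_QpsY_le_of {cb cl : ℝ} (hcb : ∀ (x : 𝔸) (k : κ), ‖b.repr x k‖ ≤ cb * ‖x‖) (hcb0 : 0 ≤ cb) (hcl : ∀ l, ‖b l‖ ≤ cl)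
    (hcl0 : 0 ≤ cl) (hKQ : 0 ≤ KQ)
    (hQsf : ∀ a ∈ ball (0 : Fin (d + 1) → Site (PV d ℓ i.m i.K hd hL) 0 → 𝔸) Rc, ∀ z s, qpsK i z s ≠ 0 →
      ‖(((qpT i parS (prodCfg U₀ η a) s z)⁻¹ : 𝔸ˣ) : 𝔸)‖ ≤ KQ)
    (hQsb : ∀ a ∈ ball (0 : Fin (d + 1) → Site (PV d ℓ i.m i.K hd hL) 0 → 𝔸) Rc, ∀ z s, qpsK i z s ≠ 0 → ‖(qpT i parS (prodCfg U₀ η a) s z : 𝔸)‖ ≤ KQ)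
    {CQsr : ℝ} (hCQsr : ∀ z, ∑ s, |qpsK i z s| ≤ CQsr)
    {a : Fin (d + 1) → Site (PV d ℓ i.m i.K hd hL) 0 → 𝔸} (ha : a ∈ ball 0 Rc) (q : SiteY i × κ) :
    ∑ p : BlkY i × κ, ‖LinearMap.toMatrix ((Pi.basis fun _ : BlkY i => b).reindex (Equiv.sigmaEquivProd (BlkY i) κ))
      ((Pi.basis fun _ : SiteY i => b).reindex (Equiv.sigmaEquivProd (SiteY i) κ)) (QpsY i parS (prodCfg U₀ η a)) q p‖ ≤
      CQsr * (Fintype.card κ : ℝ) * (cb * (KQ * cl * KQ)) := by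
  set c : ℝ := cb * (KQ * cl * KQ) with hc
  have hc0 : 0 ≤ c := mul_nonneg hcb0 (mul_nonneg (mul_nonneg hKQ hcl0) hKQ)
  calc ∑ p : BlkY i × κ, ‖LinearMap.toMatrix ((Pi.basis fun _ : BlkY i => b).reindex (Equiv.sigmaEquivProd (BlkY i) κ))
          ((Pi.basis fun _ : SiteY i => b).reindex (Equiv.sigmaEquivProd (SiteY i) κ)) (QpsY i parS (prodCfg U₀ η a)) q p‖
      ≤ ∑ p : BlkY i × κ, |qpsK i q.1 p.1| * c :=
        Finset.sum_le_sum fun p _ => norm_toMatrix_QpsY_prodCfg_le_of i b parS U₀ η hcb hcb0 hcl hKQ hQsf hQsb ha q p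
    _ = (∑ s : BlkY i, |qpsK i q.1 s|) * (Fintype.card κ : ℝ) * c := by
        rw [Fintype.sum_prod_type, Finset.sum_mul, Finset.sum_mul]
        refine Finset.sum_congr rfl fun s _ => ?_
        show ∑ _y : κ, |qpsK i q.1 s| * c = _
        rw [Finset.sum_const, Finset.card_univ, nsmul_eq_mul]
        ring
    _ ≤ CQsr * (Fintype.card κ : ℝ) * c :=
        mul_le_mul_of_nonneg_right (mul_le_mul_of_nonneg_right (hCQsr q.1) (Nat.cast_nonneg _)) hc0

omit [DecidableEq (BlkY i)] in
/-- `Q′`, ANY `parS`: COLUMN SUMS over the block index `Σ_{(s,k)} ‖toMatrix(Q′)(s,k)(z,l)‖ ≤ CQc·|κ|·(cb·(KQ·cl·KQ))`, numeral `CQc ≥ Σ_s |qpK(s,z)|`.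
[cite: Balaban1985BackgroundPropagators, (3.19) p.393; Balaban1984PropagatorsII, (2.54) p.232] -/
theorem colSum_blk_toMatrix_QpY_le_of {cb cl : ℝ} (hcb : ∀ (x : 𝔸) (k : κ), ‖b.repr x k‖ ≤ cb * ‖x‖) (hcb0 : 0 ≤ cb) (hcl : ∀ l, ‖b l‖ ≤ cl)
    (hcl0 : 0 ≤ cl) (hKQ : 0 ≤ KQ)
    (hQf : ∀ a ∈ ball (0 : Fin (d + 1) → Site (PV d ℓ i.m i.K hd hL) 0 → 𝔸) Rc, ∀ s z, qpK i s z ≠ 0 → ‖(qpT i parS (prodCfg U₀ η a) s z : 𝔸)‖ ≤ KQ)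
    (hQb : ∀ a ∈ ball (0 : Fin (d + 1) → Site (PV d ℓ i.m i.K hd hL) 0 → 𝔸) Rc, ∀ s z, qpK i s z ≠ 0 →
      ‖(((qpT i parS (prodCfg U₀ η a) s z)⁻¹ : 𝔸ˣ) : 𝔸)‖ ≤ KQ)
    {CQc : ℝ} (hCQc : ∀ z, ∑ s, |qpK i s z| ≤ CQc)
    {a : Fin (d + 1) → Site (PV d ℓ i.m i.K hd hL) 0 → 𝔸} (ha : a ∈ ball 0 Rc) (q : SiteY i × κ) :
    ∑ p : BlkY i × κ, ‖LinearMap.toMatrix ((Pi.basis fun _ : SiteY i => b).reindex (Equiv.sigmaEquivProd (SiteY i) κ))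
      ((Pi.basis fun _ : BlkY i => b).reindex (Equiv.sigmaEquivProd (BlkY i) κ)) (QpY i parS (prodCfg U₀ η a)) p q‖ ≤
      CQc * (Fintype.card κ : ℝ) * (cb * (KQ * cl * KQ)) := by
  set c : ℝ := cb * (KQ * cl * KQ) with hc
  have hc0 : 0 ≤ c := mul_nonneg hcb0 (mul_nonneg (mul_nonneg hKQ hcl0) hKQ)
  calc ∑ p : BlkY i × κ, ‖LinearMap.toMatrix ((Pi.basis fun _ : SiteY i => b).reindex (Equiv.sigmaEquivProd (SiteY i) κ))
          ((Pi.basis fun _ : BlkY i => b).reindex (Equiv.sigmaEquivProd (BlkY i) κ)) (QpY i parS (prodCfg U₀ η a)) p q‖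
      ≤ ∑ p : BlkY i × κ, |qpK i p.1 q.1| * c :=
        Finset.sum_le_sum fun p _ => norm_toMatrix_QpY_prodCfg_le_of i b parS U₀ η hcb hcb0 hcl hKQ hQf hQb ha p q
    _ = (∑ s : BlkY i, |qpK i s q.1|) * (Fintype.card κ : ℝ) * c := by
        rw [Fintype.sum_prod_type, Finset.sum_mul, Finset.sum_mul]
        refine Finset.sum_congr rfl fun s _ => ?_
        show ∑ _y : κ, |qpK i s q.1| * c = _
        rw [Finset.sum_const, Finset.card_univ, nsmul_eq_mul]
        ring
    _ ≤ CQc * (Fintype.card κ : ℝ) * c :=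
        mul_le_mul_of_nonneg_right (mul_le_mul_of_nonneg_right (hCQc q.1) (Nat.cast_nonneg _)) hc0

end Generic

/-! ## §2. The matrix of `R(U)` -/

section Identification

/-- The matrix of `R(U) = I − G′Q′*X⁻¹Q′G′` in the site-sector product basis, any `parS`, `Gp`, `U` (`LinearMap.toMatrix_id ∕ _comp`, linearity).
[cite: Balaban1985BackgroundPropagators, (3.25) p.394] -/
theorem toMatrix_RY_eq (Gp : SiteOpY 𝔸 i) (U : CfgY 𝔸 i) :
    LinearMap.toMatrix ((Pi.basis fun _ : SiteY i => b).reindex (Equiv.sigmaEquivProd (SiteY i) κ))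
      ((Pi.basis fun _ : SiteY i => b).reindex (Equiv.sigmaEquivProd (SiteY i) κ)) (RY i parS Gp U) =
    1 - LinearMap.toMatrix ((Pi.basis fun _ : SiteY i => b).reindex (Equiv.sigmaEquivProd (SiteY i) κ))
          ((Pi.basis fun _ : SiteY i => b).reindex (Equiv.sigmaEquivProd (SiteY i) κ)) (Gp U) *
      ((LinearMap.toMatrix ((Pi.basis fun _ : BlkY i => b).reindex (Equiv.sigmaEquivProd (BlkY i) κ))
            ((Pi.basis fun _ : SiteY i => b).reindex (Equiv.sigmaEquivProd (SiteY i) κ)) (QpsY i parS U) *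
          LinearMap.toMatrix ((Pi.basis fun _ : BlkY i => b).reindex (Equiv.sigmaEquivProd (BlkY i) κ))
            ((Pi.basis fun _ : BlkY i => b).reindex (Equiv.sigmaEquivProd (BlkY i) κ)) (XinvY i parS Gp U) *
          LinearMap.toMatrix ((Pi.basis fun _ : SiteY i => b).reindex (Equiv.sigmaEquivProd (SiteY i) κ))
            ((Pi.basis fun _ : BlkY i => b).reindex (Equiv.sigmaEquivProd (BlkY i) κ)) (QpY i parS U)) *
        LinearMap.toMatrix ((Pi.basis fun _ : SiteY i => b).reindex (Equiv.sigmaEquivProd (SiteY i) κ))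
          ((Pi.basis fun _ : SiteY i => b).reindex (Equiv.sigmaEquivProd (SiteY i) κ)) (Gp U)) := by
  have hR : RY i parS Gp U = LinearMap.id - Gp U ∘ₗ (QpsY i parS U ∘ₗ (XinvY i parS Gp U ∘ₗ (QpY i parS U ∘ₗ Gp U))) := rfl
  rw [hR, map_sub, LinearMap.toMatrix_id,
    LinearMap.toMatrix_comp _ ((Pi.basis fun _ : SiteY i => b).reindex (Equiv.sigmaEquivProd (SiteY i) κ)),
    LinearMap.toMatrix_comp _ ((Pi.basis fun _ : BlkY i => b).reindex (Equiv.sigmaEquivProd (BlkY i) κ)),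
    LinearMap.toMatrix_comp _ ((Pi.basis fun _ : BlkY i => b).reindex (Equiv.sigmaEquivProd (BlkY i) κ)),
    LinearMap.toMatrix_comp _ ((Pi.basis fun _ : SiteY i => b).reindex (Equiv.sigmaEquivProd (SiteY i) κ))]
  simp only [Matrix.mul_assoc]

end Identification

/-! ## §3. ★★★ `R(U)` along the pencil, transporter-generic -/

section RStation

variable {ν : ℕ} {Nf : Fin ν → ℕ} [∀ j, NeZero (Nf j)]

/-- ★★★ **THE R-STATION — `R(e^{iηA′}U₀) = I − G′Q′*X⁻¹Q′G′` ALONG pv27's PENCIL IN N10 COORDINATES, FOR ANY TRANSPORTER LETTER `parS` AND ANY `G′`-LETTER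
`Gp`** (print's «R(U′U) … analytic functions of A′», Sect. B (3.66)–(3.72)).  DISPLAYED INPUTS: `G′`'s pencil letters `(R, ρ, B_G′)` on the site sector and X⁻¹'s
pencil letters `(R, ρ, B_X)` on the block sector (the G′- and X⁻¹-junctions' outputs at a common radius and rate); §1's transporter facts (`hQh hQhi` holomorphy,
`hQf hQb hQsf hQsb` the numeral `KQ ≥ 0` on the supports); the kernel numerals `CQsr, CQc ≥ 0` and reading `r` (`qpK(s,z) ≠ 0 ⇒ d₁(ℓB s, ℓS z) ≤ r`, `qpsK(z,s) ≠ 0 ⇒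
d₁(ℓS z, ℓB s) ≤ r`); the basis numerals; a fibre bound `m_S` of `ℓS`; `0 < μ`, `2μ ≤ ρ`.  Conclusion: `RawEntryLetters (A′ ↦ toMatrix (R(e^{iηA′}U₀))) (ℓS ∘ fst) R
(ρ − 2μ) (1 + B_G′·(B_N·B_G′·M)·M)`, `M = m_S·c₀(1,μ)^ν`, `B_N = a·b·B_X·e^{2ρr}`.
[cite: Balaban1985BackgroundPropagators, (3.25) p.394, Thm 3.4 p.400, (3.66)–(3.68) p.403, (3.69)–(3.70) p.404, (3.71)–(3.72) p.405, Thm 3.10 (3.108) p.416; Balaban1988RG2Cluster, (2.5)–(2.7) pp.12–13;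
Balaban1984PropagatorsII, (2.54) p.232, Lemma 2.1 (2.61) p.234] -/
theorem rawEntryLetters_toMatrix_RY_prodCfg (Gp : SiteOpY 𝔸 i) {cb cl : ℝ}
    (hcb : ∀ (x : 𝔸) (k : κ), ‖b.repr x k‖ ≤ cb * ‖x‖) (hcb0 : 0 ≤ cb) (hcl : ∀ l, ‖b l‖ ≤ cl) (hcl0 : 0 ≤ cl) (hKQ : 0 ≤ KQ)
    (hQh : ∀ s z, DifferentiableOn ℂ (fun a : Fin (d + 1) → Site (PV d ℓ i.m i.K hd hL) 0 → 𝔸 => (qpT i parS (prodCfg U₀ η a) s z : 𝔸)) (ball 0 Rc))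
    (hQhi : ∀ s z, DifferentiableOn ℂ (fun a : Fin (d + 1) → Site (PV d ℓ i.m i.K hd hL) 0 → 𝔸 =>
      (((qpT i parS (prodCfg U₀ η a) s z)⁻¹ : 𝔸ˣ) : 𝔸)) (ball 0 Rc))
    (hQf : ∀ a ∈ ball (0 : Fin (d + 1) → Site (PV d ℓ i.m i.K hd hL) 0 → 𝔸) Rc, ∀ s z, qpK i s z ≠ 0 → ‖(qpT i parS (prodCfg U₀ η a) s z : 𝔸)‖ ≤ KQ)
    (hQb : ∀ a ∈ ball (0 : Fin (d + 1) → Site (PV d ℓ i.m i.K hd hL) 0 → 𝔸) Rc, ∀ s z, qpK i s z ≠ 0 →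
      ‖(((qpT i parS (prodCfg U₀ η a) s z)⁻¹ : 𝔸ˣ) : 𝔸)‖ ≤ KQ)
    (hQsf : ∀ a ∈ ball (0 : Fin (d + 1) → Site (PV d ℓ i.m i.K hd hL) 0 → 𝔸) Rc, ∀ z s, qpsK i z s ≠ 0 →
      ‖(((qpT i parS (prodCfg U₀ η a) s z)⁻¹ : 𝔸ˣ) : 𝔸)‖ ≤ KQ)
    (hQsb : ∀ a ∈ ball (0 : Fin (d + 1) → Site (PV d ℓ i.m i.K hd hL) 0 → 𝔸) Rc, ∀ z s, qpsK i z s ≠ 0 → ‖(qpT i parS (prodCfg U₀ η a) s z : 𝔸)‖ ≤ KQ)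
    {CQsr CQc : ℝ} (hCQsr0 : 0 ≤ CQsr) (hCQsr : ∀ z, ∑ s, |qpsK i z s| ≤ CQsr) (hCQc0 : 0 ≤ CQc) (hCQc : ∀ z, ∑ s, |qpK i s z| ≤ CQc)
    (ℓS : SiteY i → UT Nf) (ℓB : BlkY i → UT Nf) {r : ℝ}
    (hℓQ : ∀ s z, qpK i s z ≠ 0 → tdist1 Nf (ℓB s) (ℓS z) ≤ r) (hℓQs : ∀ z s, qpsK i z s ≠ 0 → tdist1 Nf (ℓS z) (ℓB s) ≤ r)
    {mS : ℕ} (hfibS : ∀ y : UT Nf, (univ.filter fun q : SiteY i × κ => ℓS q.1 = y).card ≤ mS)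
    {ρ BG BX μ : ℝ} (hρ : 0 ≤ ρ)
    (hG : RawEntryLetters (fun a : Fin (d + 1) → Site (PV d ℓ i.m i.K hd hL) 0 → 𝔸 =>
      LinearMap.toMatrix ((Pi.basis fun _ : SiteY i => b).reindex (Equiv.sigmaEquivProd (SiteY i) κ))
        ((Pi.basis fun _ : SiteY i => b).reindex (Equiv.sigmaEquivProd (SiteY i) κ)) (Gp (prodCfg U₀ η a)))
      (fun q : SiteY i × κ => ℓS q.1) Rc ρ BG)
    (hXi : RawEntryLetters (fun a : Fin (d + 1) → Site (PV d ℓ i.m i.K hd hL) 0 → 𝔸 =>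
      LinearMap.toMatrix ((Pi.basis fun _ : BlkY i => b).reindex (Equiv.sigmaEquivProd (BlkY i) κ))
        ((Pi.basis fun _ : BlkY i => b).reindex (Equiv.sigmaEquivProd (BlkY i) κ)) (XinvY i parS Gp (prodCfg U₀ η a)))
      (fun p : BlkY i × κ => ℓB p.1) Rc ρ BX)
    (hμ : 0 < μ) (h2μ : 2 * μ ≤ ρ) :
    RawEntryLetters (fun a : Fin (d + 1) → Site (PV d ℓ i.m i.K hd hL) 0 → 𝔸 =>
        LinearMap.toMatrix ((Pi.basis fun _ : SiteY i => b).reindex (Equiv.sigmaEquivProd (SiteY i) κ))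
          ((Pi.basis fun _ : SiteY i => b).reindex (Equiv.sigmaEquivProd (SiteY i) κ)) (RY i parS Gp (prodCfg U₀ η a)))
      (fun q : SiteY i × κ => ℓS q.1) Rc (ρ - 2 * μ)
      (1 + BG * (CQsr * (Fintype.card κ : ℝ) * (cb * (KQ * cl * KQ)) * (CQc * (Fintype.card κ : ℝ) * (cb * (KQ * cl * KQ))) * BX *
            Real.exp (2 * ρ * r) * BG * (mS * B6.c0 1 μ ^ ν)) * (mS * B6.c0 1 μ ^ ν)) := by
  have hc0 : 0 ≤ cb * (KQ * cl * KQ) := mul_nonneg hcb0 (mul_nonneg (mul_nonneg hKQ hcl0) hKQ)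
  have ha0 : 0 ≤ CQsr * (Fintype.card κ : ℝ) * (cb * (KQ * cl * KQ)) := mul_nonneg (mul_nonneg hCQsr0 (Nat.cast_nonneg _)) hc0
  have hb0 : 0 ≤ CQc * (Fintype.card κ : ℝ) * (cb * (KQ * cl * KQ)) := mul_nonneg (mul_nonneg hCQc0 (Nat.cast_nonneg _)) hc0
  -- the middle factor `N = Q′*·X⁻¹·Q′` on the site sector: (D′)'s sandwich, no rate loss
  have hN := rawEntryLetters_sandwich_family (locp := fun q : SiteY i × κ => ℓS q.1) hXi hρ
    (A := fun a => LinearMap.toMatrix ((Pi.basis fun _ : BlkY i => b).reindex (Equiv.sigmaEquivProd (BlkY i) κ))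
        ((Pi.basis fun _ : SiteY i => b).reindex (Equiv.sigmaEquivProd (SiteY i) κ)) (QpsY i parS (prodCfg U₀ η a)))
    (B' := fun a => LinearMap.toMatrix ((Pi.basis fun _ : SiteY i => b).reindex (Equiv.sigmaEquivProd (SiteY i) κ))
        ((Pi.basis fun _ : BlkY i => b).reindex (Equiv.sigmaEquivProd (BlkY i) κ)) (QpY i parS (prodCfg U₀ η a)))
    (r := r) ha0 hb0
    (fun q p => differentiableOn_toMatrix_QpsY_prodCfg_of i b parS U₀ η hcb hQh hQhi q p)
    (fun a _ q p hne => tdist_le_of_toMatrix_QpsY_ne_zero i b ℓS ℓB hℓQs parS (prodCfg U₀ η a) q p hne)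
    (fun a ha q => rowSum_blk_toMatrix_QpsY_le_of i b parS U₀ η hcb hcb0 hcl hcl0 hKQ hQsf hQsb hCQsr ha q)
    (fun p q => differentiableOn_toMatrix_QpY_prodCfg_of i b parS U₀ η hcb hQh hQhi p q)
    (fun a _ p q hne => tdist_le_of_toMatrix_QpY_ne_zero i b ℓS ℓB hℓQ parS (prodCfg U₀ η a) p q hne)
    (fun a ha q => colSum_blk_toMatrix_QpY_le_of i b parS U₀ η hcb hcb0 hcl hcl0 hKQ hQf hQb hCQc ha q)
  -- two square products with `G′` on the site sector, one rate loss each (34), then `1 − ·`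
  have hNG := rawEntryLetters_mul_torus hN hG hμ (κ := ρ - μ) (by linarith) (by linarith) (by linarith) hfibS
  have hGNG := rawEntryLetters_mul_torus hG hNG hμ (κ := ρ - 2 * μ) (by linarith) (by linarith) (by linarith) hfibS
  have hRes := rawEntryLetters_sub (rawEntryLetters_one (E := Fin (d + 1) → Site (PV d ℓ i.m i.K hd hL) 0 → 𝔸)
    (fun q : SiteY i × κ => ℓS q.1) Rc (ρ - 2 * μ)) hGNG
  refine rawEntryLetters_congr hRes fun a _ => ?_
  rw [toMatrix_RY_eq]

end RStation

/-! ## §4. The v2 instance: `parS := parSY`, transporter facts discharged by 73 -/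

section ParSY

variable [NormOneClass 𝔸]
variable {ν : ℕ} {Nf : Fin ν → ℕ} [∀ j, NeZero (Nf j)]

/-- **THE R-STATION AT def-Y's v2 LETTER `parSY`** (any `G′`-letter `Gp`): §3 with §1's four transporter facts discharged by 73 (`differentiableOn_qpT(_inv)_prodCfg`,
`norm_qpT(_inv)_prodCfg_le`) — `KQ = Kη^D` from the background's size `‖U₀(b)^{±1}‖ ≤ K₀`, `1 ≤ K₀` and the support numerals `D` (`qpK(s,z) ≠ 0 ∨ qpsK(z,s) ≠ 0 ⇒
tdist(chart⁻¹(corner s), chart⁻¹ z) ≤ D`).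
[cite: Balaban1985BackgroundPropagators, (3.19)–(3.21) pp.393–394, (3.25) p.394, (3.66)–(3.68) p.403, (3.69)–(3.70) p.404, (3.71)–(3.72) p.405, Thm 3.10 (3.108) p.416] -/
theorem rawEntryLetters_toMatrix_RY_parSY_prodCfg (Gp : SiteOpY 𝔸 i) {K₀ : ℝ} {D : ℕ}
    (hU : ∀ μ x, ‖(U₀ μ x : 𝔸)‖ ≤ K₀) (hUi : ∀ μ x, ‖(((U₀ μ x)⁻¹ : 𝔸ˣ) : 𝔸)‖ ≤ K₀) (hK1 : 1 ≤ K₀) (hR0 : 0 ≤ Rc)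
    (hD : ∀ s z, qpK i s z ≠ 0 → Site.tdist ((boxEquiv i.hN).symm (blkCornerY i s)) ((boxEquiv i.hN).symm z) ≤ D)
    (hDs : ∀ z s, qpsK i z s ≠ 0 → Site.tdist ((boxEquiv i.hN).symm (blkCornerY i s)) ((boxEquiv i.hN).symm z) ≤ D)
    {cb cl : ℝ} (hcb : ∀ (x : 𝔸) (k : κ), ‖b.repr x k‖ ≤ cb * ‖x‖) (hcb0 : 0 ≤ cb) (hcl : ∀ l, ‖b l‖ ≤ cl) (hcl0 : 0 ≤ cl)
    {CQsr CQc : ℝ} (hCQsr0 : 0 ≤ CQsr) (hCQsr : ∀ z, ∑ s, |qpsK i z s| ≤ CQsr) (hCQc0 : 0 ≤ CQc) (hCQc : ∀ z, ∑ s, |qpK i s z| ≤ CQc)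
    (ℓS : SiteY i → UT Nf) (ℓB : BlkY i → UT Nf) {r : ℝ}
    (hℓQ : ∀ s z, qpK i s z ≠ 0 → tdist1 Nf (ℓB s) (ℓS z) ≤ r) (hℓQs : ∀ z s, qpsK i z s ≠ 0 → tdist1 Nf (ℓS z) (ℓB s) ≤ r)
    {mS : ℕ} (hfibS : ∀ y : UT Nf, (univ.filter fun q : SiteY i × κ => ℓS q.1 = y).card ≤ mS)
    {ρ BG BX μ : ℝ} (hρ : 0 ≤ ρ)
    (hG : RawEntryLetters (fun a : Fin (d + 1) → Site (PV d ℓ i.m i.K hd hL) 0 → 𝔸 =>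
      LinearMap.toMatrix ((Pi.basis fun _ : SiteY i => b).reindex (Equiv.sigmaEquivProd (SiteY i) κ))
        ((Pi.basis fun _ : SiteY i => b).reindex (Equiv.sigmaEquivProd (SiteY i) κ)) (Gp (prodCfg U₀ η a)))
      (fun q : SiteY i × κ => ℓS q.1) Rc ρ BG)
    (hXi : RawEntryLetters (fun a : Fin (d + 1) → Site (PV d ℓ i.m i.K hd hL) 0 → 𝔸 =>
      LinearMap.toMatrix ((Pi.basis fun _ : BlkY i => b).reindex (Equiv.sigmaEquivProd (BlkY i) κ))
        ((Pi.basis fun _ : BlkY i => b).reindex (Equiv.sigmaEquivProd (BlkY i) κ)) (XinvY i (parSY i) Gp (prodCfg U₀ η a)))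
      (fun p : BlkY i × κ => ℓB p.1) Rc ρ BX)
    (hμ : 0 < μ) (h2μ : 2 * μ ≤ ρ) :
    RawEntryLetters (fun a : Fin (d + 1) → Site (PV d ℓ i.m i.K hd hL) 0 → 𝔸 =>
        LinearMap.toMatrix ((Pi.basis fun _ : SiteY i => b).reindex (Equiv.sigmaEquivProd (SiteY i) κ))
          ((Pi.basis fun _ : SiteY i => b).reindex (Equiv.sigmaEquivProd (SiteY i) κ)) (RY i (parSY i) Gp (prodCfg U₀ η a)))
      (fun q : SiteY i × κ => ℓS q.1) Rc (ρ - 2 * μ)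
      (1 + BG * (CQsr * (Fintype.card κ : ℝ) * (cb * ((K₀ * Real.exp (|η| * Rc)) ^ D * cl * (K₀ * Real.exp (|η| * Rc)) ^ D)) *
            (CQc * (Fintype.card κ : ℝ) * (cb * ((K₀ * Real.exp (|η| * Rc)) ^ D * cl * (K₀ * Real.exp (|η| * Rc)) ^ D))) * BX *
            Real.exp (2 * ρ * r) * BG * (mS * B6.c0 1 μ ^ ν)) * (mS * B6.c0 1 μ ^ ν)) := by
  have h1 : (1 : ℝ) ≤ K₀ * Real.exp (|η| * Rc) := one_le_mul_of_one_le_of_one_le hK1 (Real.one_le_exp (mul_nonneg (abs_nonneg _) hR0))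
  have hKQ : 0 ≤ (K₀ * Real.exp (|η| * Rc)) ^ D := pow_nonneg (zero_le_one.trans h1) D
  refine rawEntryLetters_toMatrix_RY_prodCfg i b (parSY i) U₀ η Gp hcb hcb0 hcl hcl0 hKQ
    (fun s z => differentiableOn_qpT_prodCfg i U₀ η s z) (fun s z => differentiableOn_qpT_inv_prodCfg i U₀ η s z)
    (fun a ha s z hM => (norm_qpT_prodCfg_le i U₀ η hU hUi hR0 ha s z).trans (pow_le_pow_right₀ h1 (hD s z hM)))
    (fun a ha s z hM => (norm_qpT_inv_prodCfg_le i U₀ η hU hUi hR0 ha s z).trans (pow_le_pow_right₀ h1 (hD s z hM)))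
    (fun a ha z s hM => (norm_qpT_inv_prodCfg_le i U₀ η hU hUi hR0 ha s z).trans (pow_le_pow_right₀ h1 (hDs z s hM)))
    (fun a ha z s hM => (norm_qpT_prodCfg_le i U₀ η hU hUi hR0 ha s z).trans (pow_le_pow_right₀ h1 (hDs z s hM)))
    hCQsr0 hCQsr hCQc0 hCQc ℓS ℓB hℓQ hℓQs hfibS hρ hG hXi hμ h2μ

end ParSY

end Literature.MathematicalPhysics.QuantumFieldTheory.Balaban1983to89.B13OpsYPencilRProj

end
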